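import Summits.AtomisticToContinuum.Crystallization.Theorems.ExcessDecayLiouvilleHcpLiouvilleSecantZeroOfBox
import Summits.AtomisticToContinuum.Crystallization.Theorems.ExcessDecayLiouvilleHcpLiouvilleAnchoredBlowdown
import Summits.AtomisticToContinuum.Crystallization.Theorems.ExcessDecayLiouvilleHcpLiouvilleSymmetricShiftConformal

/-!
# `ExcessDecayLiouville.HcpLiouville` (stmt-AtomisticToContinuum-9332): the ANCHORED Liouville theorem modulo one tangent certificate

Line `Sketch`, skeleton v5.1 (lead c2), composition B.  Two registered sub-goals of the crux, both sorry-free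
consequences of the landed stubs `stub_secantZero_of_box` (p150804), `stub_anchoredBlowdown` (p151370) and
`hcpLiouville_symmetricShift_uniaxial` (p153218):

* `anchoredLiouville_of_box` — **the coarse Liouville theorem for EQUILIBRIUM data, modulo the tangent box
  certificate**: if, about every admissible hcp-like datum whose site set is in Lennard-Jones force balance, the
  second variation at every displaced configuration `w` with `‖w s‖ ≤ 1/40` dominates `κ ×` the nearest-neighbour
  strain form (`κ > 0`; the registered computational stub `stub_anchoredBox`), then (under harmonic stability) every
  separated Lennard-Jones equilibrium globally two-way `1/40`-matched with such a datum IS an admissible affine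
  two-lattice.  This is child `AnchoredLiouville` of the strategist's split (Cruxes/HcpLiouville/DECOMPOSITION.md)
  reduced to ONE certificate at vertex radius `1/40` (anchor shift `0`, no θ-integral).
* `hcpLiouville_uniaxial_exact_of_box` — **the crux itself for uniaxial cells with the exact geometric shift,
  modulo the same certificate**: for `A = Q ∘ (x ↦ s x + r x₂ e₃)` (every c/a ratio and basal scale, any
  orientation) and a datum with `t 1 − t 0 = A (w₀ + √(2/3) e₃)` exactly, the datum is an equilibrium two-lattice
  (`hcpLiouville_symmetricShift_uniaxial`), so no re-anchoring (`EquilibriumAnchoring`) is needed.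

All `[folklore]`; `--supports` helpers for item stmt-AtomisticToContinuum-9332, nothing here closes the item.
-/

noncomputable section

namespace Summit.AtomisticToContinuum.Crystallization.Theorems.ExcessDecayLiouville

open scoped BigOperators Topology Classical InnerProductSpace
open Literature.MathematicalPhysics.StatisticalMechanics
open Summit.AtomisticToContinuum.Crystallization.Theses.ExcessDecayLiouville
open Summit.AtomisticToContinuum.Crystallization.Theorems.PhononStabilityNegative

local notation "E3" => EuclideanSpace ℝ (Fin 3)

/-- **Anchored Liouville modulo the tangent box certificate** (registered sub-goal of crux
stmt-AtomisticToContinuum-9332, line `Sketch` v5.1, composition B): tangent box coercivity at vertex radius `1/40`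
about equilibrium data (constant `κ > 0`) and harmonic stability imply that every `δ`-separated Lennard-Jones
equilibrium globally two-way `1/40`-matched with an admissible hcp-like EQUILIBRIUM datum is an admissible affine
two-lattice.  Proof: `stub_secantZero_of_box` turns the certificate into `SecantCoercive 0 κ`, and
`stub_anchoredBlowdown` is the blow-down at anchor shift `0`. [folklore] -/
theorem anchoredLiouville_of_box :
    ∀ κ : ℝ, 0 < κ →
      (∀ (t : Fin 2 → E3) (A : E3 →L[ℝ] E3), Adm₀ A → Inner₀ t A → Equil₀ (Sites₀ t A) →
        ∀ w : E3 → E3, (∀ s ∈ Sites₀ t A, ‖w s‖ ≤ 1 / 40) →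
          ∀ φ : E3 → E3, (Function.support φ).Finite → Function.support φ ⊆ Sites₀ t A →
            κ * nnForm t A φ ≤ hessFormAt t A w φ / 2) →
      PhononStability → ∀ δ : ℝ, 0 < δ → ∀ X : Set E3, Sep₀ X δ → Equil₀ X →
        ∀ (t : Fin 2 → E3) (A : E3 →L[ℝ] E3), Adm₀ A → Inner₀ t A → Equil₀ (Sites₀ t A) →
          (∀ (c : E3) (r : ℝ), Near₀ X c r t A (1 / 40)) →
            ∃ (t' : Fin 2 → E3) (A' : E3 →L[ℝ] E3), Adm₀ A' ∧ X = Sites₀ t' A' :=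
  fun κ hκ hbox hPS => stub_anchoredBlowdown hPS κ hκ (stub_secantZero_of_box κ hbox)

/-- **The crux for uniaxial exactly-shifted data, modulo the tangent box certificate** (registered sub-goal of crux
stmt-AtomisticToContinuum-9332, line `Sketch` v5.1): for a uniaxial admissible cell `A = Q ∘ (x ↦ s x + r x₂ e₃)`
and a datum with the EXACT geometric inner shift `t 1 − t 0 = A (w₀ + √(2/3) e₃)`, every `δ`-separated Lennard-Jones
equilibrium globally two-way `1/40`-matched with the datum is an admissible affine two-lattice — the datum is itself an
equilibrium two-lattice by `hcpLiouville_symmetricShift_uniaxial` (its optical force vanishes by the 3-fold axis and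
the basal mirror), so `anchoredLiouville_of_box` applies. [folklore] -/
theorem hcpLiouville_uniaxial_exact_of_box :
    ∀ κ : ℝ, 0 < κ →
      (∀ (t : Fin 2 → E3) (A : E3 →L[ℝ] E3), Adm₀ A → Inner₀ t A → Equil₀ (Sites₀ t A) →
        ∀ w : E3 → E3, (∀ s ∈ Sites₀ t A, ‖w s‖ ≤ 1 / 40) →
          ∀ φ : E3 → E3, (Function.support φ).Finite → Function.support φ ⊆ Sites₀ t A →
            κ * nnForm t A φ ≤ hessFormAt t A w φ / 2) →
      PhononStability → ∀ δ : ℝ, 0 < δ → ∀ X : Set E3, Sep₀ X δ → Equil₀ X →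
        ∀ (t : Fin 2 → E3) (A : E3 →L[ℝ] E3) (s r : ℝ) (Q : E3 ≃ₗᵢ[ℝ] E3), Adm₀ A →
          (∀ x : E3, A x = Q (s • x + (r * x 2) • layerNormal 1)) →
          t 1 - t 0 = A (barlowOffset 1 + layerNormal (Real.sqrt (2 / 3))) →
          (∀ (c : E3) (r : ℝ), Near₀ X c r t A (1 / 40)) →
            ∃ (t' : Fin 2 → E3) (A' : E3 →L[ℝ] E3), Adm₀ A' ∧ X = Sites₀ t' A' := by
  intro κ hκ hbox hPS δ hδ X hSep hEq t A s r Q hA hAQ ht hN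
  have hI : Inner₀ t A := by
    unfold Inner₀; rw [ht, sub_self, norm_zero]; norm_num
  have hE : Equil₀ (Sites₀ t A) := by
    rw [equil₀_sites_iff_hasSum hA hI, ht]
    exact hcpLiouville_symmetricShift_uniaxial A s r Q hA hAQ
  exact anchoredLiouville_of_box κ hκ hbox hPS δ hδ X hSep hEq t A hA hI hE hN

end Summit.AtomisticToContinuum.Crystallization.Theorems.ExcessDecayLiouville

end
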